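import Literature.AlgebraicGeometry.Motives.DominatedVarietiesFrobeniusSplitting
import HarnessLib

/-!
# `χ(σ | Hⁱ(V)) = χ(σ | Ker) · χ(σ | Hⁱ(U))` and `tr(Fᵐ | Hⁱ(V)) = tr(Fᵐ | Ker) + tr(Fᵐ | Hⁱ(U))`

Continuation of `DominatedVarietiesFrobeniusSplitting`. Let `E : GaloisWeilCohomology k K χ` and let
`U` (`dim U = M`) be dominated by `V` (`dim V = N = M + r`) through `f : V ⟶ U` and `ζ ∈ Aʳ(V)_ℚ`
with `f₊ ζ ≠ 0` (Kleiman 1968 Prop. 1.2.4, Kahn 2020 Lemma 6.30 (2)); `g = f₊ (· ∪ ζ) : Hⁱ(V) → Hⁱ(U)`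
is a `Γ_k`-equivariant surjection (`ρ_comp_pushforward_cup`, `pushforward_cup_surjective`), so that
`0 → Ker g → Hⁱ(V) → Hⁱ(U) → 0` is an exact sequence of `Γ_k`-representations. Hence, for **every**
`σ ∈ Γ_k` (not only the Frobenius of the previous file):

* `charpoly_ρ_eq_restrict_mul`: **`det(T - σ | Hⁱ(V)) = det(T - σ | Ker g) · det(T - σ | Hⁱ(U))`**
  (Bourbaki A VIII § 20 n° 6);
* `trace_ρ_eq_trace_restrict_add`: **`tr(σ | Hⁱ(V)) = tr(σ | Ker g) + tr(σ | Hⁱ(U))`** (the trace is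
  minus the second coefficient of the characteristic polynomial, `trace_eq_add_of_charpoly_eq_mul`);
* over a finite field, with `σ = Fᵐ`: **`tr(Fᵐ | Hⁱ(V)) = tr(Fᵐ | Ker g) + tr(Fᵐ | Hⁱ(U))`**
  (`frobTracePow_eq_trace_restrict_add`; Deligne 1974 (1.5.1)), the cohomological side of
  `#V(𝔽_{qᵐ}) - #U(𝔽_{qᵐ})` under the Lefschetz trace formula;
* the equidimensional versions with `g = f₊` (`f` of non-zero degree): `σ ∘ f₊ = f₊ ∘ σ`
  (`ρ_comp_pushforward_of_dim_eq`), `det(T - σ | Hⁱ(V)) = det(T - σ | Ker f₊) · det(T - σ | Hⁱ(U))`,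
  `tr(Fᵐ | Hⁱ(V)) = tr(Fᵐ | Ker f₊) + tr(Fᵐ | Hⁱ(U))`.

Theorems only (no definition, no named fact, no instance).

## References

* [BourbakiAlgebreVIII2012] N. Bourbaki, *Algèbre*, Ch. VIII (2012), § 20 n° 6 (p. 377).
* [Deligne1974] P. Deligne, *La conjecture de Weil. I*, Publ. Math. IHÉS 43 (1974), (1.5.1), (1.5.4).
* [Kahn2020] B. Kahn, *Zeta and L-functions of varieties and motives* (2020), §3.5.1, §6.9 Lemma 6.30 (2).
* [Kleiman1968AlgebraicCycles] S. Kleiman, *Algebraic cycles and the Weil conjectures* (1968),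
  §1.2 Prop. 1.2.4.
* [Tate1994] J. Tate, *Conjectures on algebraic cycles in ℓ-adic cohomology* (1994), §1.
-/

universe u v

open CategoryTheory AlgebraicGeometry Polynomial

noncomputable section

namespace Literature.AlgebraicGeometry.Motives

/-! ## Linear algebra: the trace is additive when the characteristic polynomial is multiplicative -/

/-- `tr f = -(second coefficient of det(T - f))` for an endomorphism of a finite-dimensional vector
space (Mathlib `Matrix.trace_eq_neg_charpoly_nextCoeff` in a basis; cf. the tree's
`AbelianVariety.trace_eq_neg_nextCoeff_charpoly`, not imported here to keep the import light).
[cite: BourbakiAlgebreVIII2012, VIII § 20 n° 6 (p. 377)] -/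
private theorem LinearMap.trace_eq_neg_nextCoeff_charpoly' {F : Type u} [Field F] {V : Type v}
    [AddCommGroup V] [Module F V] [FiniteDimensional F V] (f : V →ₗ[F] V) :
    LinearMap.trace F V f = -f.charpoly.nextCoeff := by
  classical
  rw [LinearMap.trace_eq_matrix_trace F (Module.finBasis F V) f, Matrix.trace_eq_neg_charpoly_nextCoeff,
    LinearMap.charpoly_toMatrix]

/-- **`tr f = tr g + tr h` whenever `det(T - f) = det(T - g) · det(T - h)`** (the traces are minus
the second coefficients of the monic characteristic polynomials, which add under products;
Bourbaki A VIII § 20 n° 6). [cite: BourbakiAlgebreVIII2012, VIII § 20 n° 6 (p. 377)] -/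
theorem LinearMap.trace_eq_add_of_charpoly_eq_mul {F : Type u} [Field F] {V : Type v}
    [AddCommGroup V] [Module F V] [FiniteDimensional F V] {S : Type*} [AddCommGroup S] [Module F S]
    [FiniteDimensional F S] {Q : Type*} [AddCommGroup Q] [Module F Q] [FiniteDimensional F Q]
    (f : V →ₗ[F] V) (g : S →ₗ[F] S) (h : Q →ₗ[F] Q) (hc : f.charpoly = g.charpoly * h.charpoly) :
    LinearMap.trace F V f = LinearMap.trace F S g + LinearMap.trace F Q h := by
  rw [LinearMap.trace_eq_neg_nextCoeff_charpoly', LinearMap.trace_eq_neg_nextCoeff_charpoly',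
    LinearMap.trace_eq_neg_nextCoeff_charpoly', hc,
    Polynomial.Monic.nextCoeff_mul g.charpoly_monic h.charpoly_monic, neg_add]

namespace GaloisWeilCohomology

variable {k : Type u} [Field k] {K : Type v} [Field K] [CharZero K]
  {χ : Field.absoluteGaloisGroup k →* Kˣ} (E : GaloisWeilCohomology k K χ)
variable {N M r : ℕ} {V U : SchemeOver k}

/-! ## Every `σ ∈ Γ_k`: `det(T - σ | Hⁱ(V)) = det(T - σ | Ker g) · det(T - σ | Hⁱ(U))` -/

/-- **`det(T - σ | Hⁱ(V)) = det(T - σ | Ker f₊(· ∪ ζ)) · det(T - σ | Hⁱ(U))` for every `σ ∈ Γ_k`** and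
`U` dominated by `V`: `0 → Ker g → Hⁱ(V) —g→ Hⁱ(U) → 0` (`g = f₊ (· ∪ ζ)`) is exact and
`σ`-equivariant (`ρ_comp_pushforward_cup`, `pushforward_cup_surjective`); the characteristic
polynomial is multiplicative along equivariant exact sequences (Bourbaki A VIII § 20 n° 6). The
`σ`-stability of `Ker g` is the hypothesis `hst` (supplied by `ρ_mem_ker_pushforward_cup`).
Degrees: `i + i' = 2M`, `i + 2r + i' = 2N`. [cite: BourbakiAlgebreVIII2012, VIII § 20 n° 6 (p. 377)] [cite: Tate1994, §1] -/
theorem charpoly_ρ_eq_restrict_mul (hV : IsSmoothProjective N V) (hU : IsSmoothProjective M U)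
    (f : V ⟶ U) {ζ : E.obj V (2 * r)} (hζ : ζ ∈ E.ratAlgebraicClasses V r)
    {he : 2 * r + 2 * M = 2 * N} {hd : 0 + 2 * M = 2 * M}
    (hne : E.pushforward (N := N) hU f he hd ζ ≠ 0) {i i' : ℕ} (hi : i + i' = 2 * M)
    (he' : i + 2 * r + i' = 2 * N) (σ : Field.absoluteGaloisGroup k)
    (hst : ∀ x ∈ LinearMap.ker
        (E.pushforward (N := N) hU f he' hi ∘ₗ (E.cup (rfl : i + 2 * r = i + 2 * r)).flip ζ),
      E.ρ V i σ x ∈ LinearMap.ker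
        (E.pushforward (N := N) hU f he' hi ∘ₗ (E.cup (rfl : i + 2 * r = i + 2 * r)).flip ζ)) :
    (haveI := E.finite_obj hV i; (E.ρ V i σ).charpoly) =
      (haveI := E.finite_obj hV i; ((E.ρ V i σ).restrict hst).charpoly) *
        (haveI := E.finite_obj hU i; (E.ρ U i σ).charpoly) := by
  haveI := E.finite_obj hV i
  haveI := E.finite_obj hU i
  exact Literature.RepresentationTheory.Semisimple.LinearMap.charpoly_eq_mul_of_exact (E.ρ V i σ)
    (LinearMap.ker _).subtype _ (LinearMap.ker _).injective_subtype
    (E.pushforward_cup_surjective hV hU f hζ hne hi he') (Submodule.range_subtype _)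
    ((E.ρ V i σ).restrict hst) (E.ρ U i σ) (LinearMap.ext fun x ↦ rfl)
    (E.ρ_comp_pushforward_cup hV hU f (by omega) hζ hi he' σ).symm

/-- **`tr(σ | Hⁱ(V)) = tr(σ | Ker f₊(· ∪ ζ)) + tr(σ | Hⁱ(U))`** for every `σ ∈ Γ_k` and `U` dominated
by `V` (`charpoly_ρ_eq_restrict_mul` and `trace_eq_add_of_charpoly_eq_mul`).
[cite: BourbakiAlgebreVIII2012, VIII § 20 n° 6 (p. 377)] [cite: Tate1994, §1] -/
theorem trace_ρ_eq_trace_restrict_add (hV : IsSmoothProjective N V) (hU : IsSmoothProjective M U)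
    (f : V ⟶ U) {ζ : E.obj V (2 * r)} (hζ : ζ ∈ E.ratAlgebraicClasses V r)
    {he : 2 * r + 2 * M = 2 * N} {hd : 0 + 2 * M = 2 * M}
    (hne : E.pushforward (N := N) hU f he hd ζ ≠ 0) {i i' : ℕ} (hi : i + i' = 2 * M)
    (he' : i + 2 * r + i' = 2 * N) (σ : Field.absoluteGaloisGroup k)
    (hst : ∀ x ∈ LinearMap.ker
        (E.pushforward (N := N) hU f he' hi ∘ₗ (E.cup (rfl : i + 2 * r = i + 2 * r)).flip ζ),
      E.ρ V i σ x ∈ LinearMap.ker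
        (E.pushforward (N := N) hU f he' hi ∘ₗ (E.cup (rfl : i + 2 * r = i + 2 * r)).flip ζ)) :
    LinearMap.trace K (E.obj V i) (E.ρ V i σ) =
      LinearMap.trace K _ ((E.ρ V i σ).restrict hst) + LinearMap.trace K (E.obj U i) (E.ρ U i σ) := by
  haveI := E.finite_obj hV i
  haveI := E.finite_obj hU i
  exact LinearMap.trace_eq_add_of_charpoly_eq_mul _ _ _
    (E.charpoly_ρ_eq_restrict_mul hV hU f hζ hne hi he' σ hst)

/-! ## The equidimensional case: `g = f₊` -/

/-- **`σ ∘ f₊ = f₊ ∘ σ` for `f : V ⟶ U` between varieties of the same dimension** and every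
`σ ∈ Γ_k` (the twist `χ(σ)^{M-N}` of `pushforward_ρ` is trivial). [cite: Kahn2020, §3.5.1] [cite: Tate1994, §1] -/
theorem ρ_comp_pushforward_of_dim_eq (hV : IsSmoothProjective N V) (hU : IsSmoothProjective N U)
    (f : V ⟶ U) {e d c : ℕ} (he : e + c = 2 * N) (hd : d + c = 2 * N)
    (σ : Field.absoluteGaloisGroup k) :
    E.ρ U d σ ∘ₗ E.pushforward (N := N) hU f he hd = E.pushforward (N := N) hU f he hd ∘ₗ E.ρ V e σ :=
  LinearMap.ext fun α ↦ by
    rw [LinearMap.comp_apply, LinearMap.comp_apply, E.pushforward_ρ hV hU f he hd σ α, sub_self,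
      zpow_zero, one_smul]

/-- `Ker f₊ ⊆ Hⁱ(V)` is a subrepresentation for `f : V ⟶ U` equidimensional. [cite: Tate1994, §1] -/
theorem ρ_mem_ker_pushforward_of_dim_eq (hV : IsSmoothProjective N V) (hU : IsSmoothProjective N U)
    (f : V ⟶ U) {i i' : ℕ} (hi : i + i' = 2 * N) (σ : Field.absoluteGaloisGroup k) {x : E.obj V i}
    (hx : x ∈ LinearMap.ker (E.pushforward (N := N) hU f hi hi)) :
    E.ρ V i σ x ∈ LinearMap.ker (E.pushforward (N := N) hU f hi hi) := by
  rw [LinearMap.mem_ker] at hx ⊢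
  rw [← LinearMap.comp_apply, ← E.ρ_comp_pushforward_of_dim_eq hV hU f hi hi σ, LinearMap.comp_apply,
    hx, map_zero]

/-- **`det(T - σ | Hⁱ(V)) = det(T - σ | Ker f₊) · det(T - σ | Hⁱ(U))` for `f : V ⟶ U` of non-zero
degree** between varieties of the same dimension, for every `σ ∈ Γ_k` (`f₊` is onto and
`σ`-equivariant). [cite: BourbakiAlgebreVIII2012, VIII § 20 n° 6 (p. 377)] [cite: Tate1994, §1] -/
theorem charpoly_ρ_eq_restrict_ker_pushforward_mul (hV : IsSmoothProjective N V)
    (hU : IsSmoothProjective N U) (f : V ⟶ U) (hf : E.pullback f (2 * N) ≠ 0) {i i' : ℕ}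
    (hi : i + i' = 2 * N) (σ : Field.absoluteGaloisGroup k)
    (hst : ∀ x ∈ LinearMap.ker (E.pushforward (N := N) hU f hi hi),
      E.ρ V i σ x ∈ LinearMap.ker (E.pushforward (N := N) hU f hi hi)) :
    (haveI := E.finite_obj hV i; (E.ρ V i σ).charpoly) =
      (haveI := E.finite_obj hV i; ((E.ρ V i σ).restrict hst).charpoly) *
        (haveI := E.finite_obj hU i; (E.ρ U i σ).charpoly) := by
  haveI := E.finite_obj hV i
  haveI := E.finite_obj hU i
  have hsurj : Function.Surjective (E.pushforward (N := N) hU f hi hi) :=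
    (E.pushforward_surjective_iff hV hU f hi hi).mpr
      (E.pullback_injective_of_pullback_top_ne_zero hV hU f hf i')
  exact Literature.RepresentationTheory.Semisimple.LinearMap.charpoly_eq_mul_of_exact (E.ρ V i σ)
    (LinearMap.ker _).subtype (E.pushforward (N := N) hU f hi hi) (LinearMap.ker _).injective_subtype
    hsurj (Submodule.range_subtype _) ((E.ρ V i σ).restrict hst) (E.ρ U i σ)
    (LinearMap.ext fun x ↦ rfl) (E.ρ_comp_pushforward_of_dim_eq hV hU f hi hi σ).symm

/-- **`tr(σ | Hⁱ(V)) = tr(σ | Ker f₊) + tr(σ | Hⁱ(U))`** for `f : V ⟶ U` of non-zero degree between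
varieties of the same dimension, every `σ ∈ Γ_k`. [cite: BourbakiAlgebreVIII2012, VIII § 20 n° 6 (p. 377)] [cite: Tate1994, §1] -/
theorem trace_ρ_eq_trace_restrict_ker_pushforward_add (hV : IsSmoothProjective N V)
    (hU : IsSmoothProjective N U) (f : V ⟶ U) (hf : E.pullback f (2 * N) ≠ 0) {i i' : ℕ}
    (hi : i + i' = 2 * N) (σ : Field.absoluteGaloisGroup k)
    (hst : ∀ x ∈ LinearMap.ker (E.pushforward (N := N) hU f hi hi),
      E.ρ V i σ x ∈ LinearMap.ker (E.pushforward (N := N) hU f hi hi)) :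
    LinearMap.trace K (E.obj V i) (E.ρ V i σ) =
      LinearMap.trace K _ ((E.ρ V i σ).restrict hst) + LinearMap.trace K (E.obj U i) (E.ρ U i σ) := by
  haveI := E.finite_obj hV i
  haveI := E.finite_obj hU i
  exact LinearMap.trace_eq_add_of_charpoly_eq_mul _ _ _
    (E.charpoly_ρ_eq_restrict_ker_pushforward_mul hV hU f hf hi σ hst)

/-! ## Finite fields: `tr(Fᵐ | Hⁱ(V)) = tr(Fᵐ | Ker) + tr(Fᵐ | Hⁱ(U))` -/

section Frobenius

variable [Finite k]

/-- **`tr(Fᵐ | Hⁱ(V)) = tr(Fᵐ | Ker f₊(· ∪ ζ)) + tr(Fᵐ | Hⁱ(U))` for `U` dominated by `V`** over a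
finite field (`E.frobTracePow`; `σ = Fᵐ` in `trace_ρ_eq_trace_restrict_add`): under the Lefschetz
trace formula the alternating sum of the middle terms is `#V(𝔽_{qᵐ}) - #U(𝔽_{qᵐ})`
(Deligne 1974 (1.5.1)). [cite: Deligne1974, (1.5.1)] [cite: BourbakiAlgebreVIII2012, VIII § 20 n° 6 (p. 377)] -/
theorem frobTracePow_eq_trace_restrict_add (hV : IsSmoothProjective N V)
    (hU : IsSmoothProjective M U) (f : V ⟶ U) {ζ : E.obj V (2 * r)}
    (hζ : ζ ∈ E.ratAlgebraicClasses V r) {he : 2 * r + 2 * M = 2 * N} {hd : 0 + 2 * M = 2 * M}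
    (hne : E.pushforward (N := N) hU f he hd ζ ≠ 0) {i i' : ℕ} (hi : i + i' = 2 * M)
    (he' : i + 2 * r + i' = 2 * N) (m : ℕ)
    (hst : ∀ x ∈ LinearMap.ker
        (E.pushforward (N := N) hU f he' hi ∘ₗ (E.cup (rfl : i + 2 * r = i + 2 * r)).flip ζ),
      E.ρ V i (geomFrob k ^ m) x ∈ LinearMap.ker
        (E.pushforward (N := N) hU f he' hi ∘ₗ (E.cup (rfl : i + 2 * r = i + 2 * r)).flip ζ)) :
    E.frobTracePow V i m =
      LinearMap.trace K _ ((E.ρ V i (geomFrob k ^ m)).restrict hst) + E.frobTracePow U i m := by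
  rw [E.frobTracePow_eq_trace_ρ, E.frobTracePow_eq_trace_ρ]
  exact E.trace_ρ_eq_trace_restrict_add hV hU f hζ hne hi he' (geomFrob k ^ m) hst

/-- **`tr(Fᵐ | Hⁱ(V)) = tr(Fᵐ | Ker f₊) + tr(Fᵐ | Hⁱ(U))` for `f : V ⟶ U` of non-zero degree**
between varieties of the same dimension over a finite field. [cite: Deligne1974, (1.5.1)]
[cite: BourbakiAlgebreVIII2012, VIII § 20 n° 6 (p. 377)] -/
theorem frobTracePow_eq_trace_restrict_ker_pushforward_add (hV : IsSmoothProjective N V)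
    (hU : IsSmoothProjective N U) (f : V ⟶ U) (hf : E.pullback f (2 * N) ≠ 0) {i i' : ℕ}
    (hi : i + i' = 2 * N) (m : ℕ)
    (hst : ∀ x ∈ LinearMap.ker (E.pushforward (N := N) hU f hi hi),
      E.ρ V i (geomFrob k ^ m) x ∈ LinearMap.ker (E.pushforward (N := N) hU f hi hi)) :
    E.frobTracePow V i m =
      LinearMap.trace K _ ((E.ρ V i (geomFrob k ^ m)).restrict hst) + E.frobTracePow U i m := by
  rw [E.frobTracePow_eq_trace_ρ, E.frobTracePow_eq_trace_ρ]
  exact E.trace_ρ_eq_trace_restrict_ker_pushforward_add hV hU f hf hi (geomFrob k ^ m) hst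

end Frobenius

end GaloisWeilCohomology

end Literature.AlgebraicGeometry.Motives
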